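import Summits.AtomisticToContinuum.Crystallization.Theorems.ExcessDecayLiouvillePhononStabilityCertIvl
import Summits.AtomisticToContinuum.Crystallization.Theorems.ExcessDecayLiouvillePhononStabilityCertSliceRep

/-!
# Near-certificate layer V5-c2a: the second-derivative matrix of a class model term and its enclosure (lead c2, vertex scheme)

Support file for crux `PhononStability` (stmt-AtomisticToContinuum-9333), line `contragredient-window-collapse`.

For a class `c` (data `ρ̄, P, Z, Λ` as in layer V5-b) and a chart variable `v`, the second `v`-derivative of the
class model term at a point `y` of a box is the pair form of the matrix `stilde … y` (`g2_sum_eq_stilde`, from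
`g2Mat` of the two slice terms; formal partial derivatives `spD`, `mpD`).  This file ENCLOSES that matrix over a box
of variable intervals by the interval arithmetic of layer V5-c1 (`stildeIvl`, sound: `mem_stildeIvl`, through the
outer-function intervals `phiIvls` and `d2Ivl`).  The frame dominator and the concavity conclusion are layer V5-c2b.
-/

noncomputable section

open scoped BigOperators
open Set Function
open Summit.AtomisticToContinuum.Crystallization.Theorems.PhononStabilityNegative

namespace Summit.AtomisticToContinuum.Crystallization.Theorems.PhononStabilityCWC.Cert

local notation "E3" => EuclideanSpace ℝ (Fin 3)

/-! ## Formal partial derivatives along a variable -/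

/-- the formal `v`-derivative of a polynomial of `v`-degree `≤ 2`: `c₁ + 2 x_v c₂` -/
def spD (P : SPoly) (v : ℕ) : SPoly := spCoeff P v 1 ++ (spCoeff P v 2).map fun e => (v :: e.1, 2 * e.2)

/-- the formal `v`-derivative of a polynomial matrix of `v`-degree `≤ 2` -/
def mpD (L : List (Mono × Mat)) (v : ℕ) : List (Mono × Mat) :=
  mpCoeff L v 1 ++ (mpCoeff L v 2).map fun e => (v :: e.1, mscale 2 e.2)

/-- an erased monomial does not see the variable. [folklore] -/
theorem monoVal_monoErase_update (x : ℕ → ℝ) (v : ℕ) (t : ℝ) (m : Mono) :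
    monoVal (update x v t) (monoErase v m) = monoVal x (monoErase v m) := by
  induction m with
  | nil => simp [monoErase, monoVal]
  | cons a m ih =>
      by_cases ha : a = v
      · subst ha
        have he : monoErase a (a :: m) = monoErase a m := by simp [monoErase]
        rw [he, ih]
      · have he : monoErase v (a :: m) = a :: monoErase v m := by simp [monoErase, ha]
        rw [he, monoVal_cons', monoVal_cons', ih, update_of_ne ha]

/-- coefficient polynomials do not see the variable. [folklore] -/
theorem spEval_spCoeff_update (P : SPoly) (v k : ℕ) (x : ℕ → ℝ) (t : ℝ) :
    spEval (spCoeff P v k) (update x v t) = spEval (spCoeff P v k) x := by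
  unfold spCoeff
  induction P with
  | nil => simp
  | cons e P ih =>
      rw [List.filter_cons]
      split
      · simp only [List.map_cons, spEval_cons, monoVal_monoErase_update, ih]
      · exact ih

/-- coefficient matrix polynomials do not see the variable. [folklore] -/
theorem matVal_mpCoeff_update (L : List (Mono × Mat)) (v k : ℕ) (x : ℕ → ℝ) (t : ℝ) (i j : Fin 3) :
    matVal (update x v t) (mpCoeff L v k) i j = matVal x (mpCoeff L v k) i j := by
  unfold mpCoeff
  induction L with
  | nil => simp [matVal]
  | cons e L ih =>
      rw [List.filter_cons]
      split
      · simp only [List.map_cons, matVal_cons, monoVal_monoErase_update, ih]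
      · exact ih

/-- evaluation of a mapped "prepend `v`, scale" polynomial. [folklore] -/
theorem spEval_map_prepend (Q : SPoly) (v : ℕ) (a : ℚ) (y : ℕ → ℝ) :
    spEval (Q.map fun e => (v :: e.1, a * e.2)) y = (a : ℝ) * y v * spEval Q y := by
  induction Q with
  | nil => simp
  | cons e Q ih =>
      rw [List.map_cons, spEval_cons, spEval_cons, ih, monoVal_cons']
      push_cast; ring

/-- evaluation of a mapped "prepend `v`, scale" polynomial matrix. [folklore] -/
theorem matVal_map_prepend (Q : List (Mono × Mat)) (v : ℕ) (a : ℚ) (y : ℕ → ℝ) (i j : Fin 3) :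
    matVal y (Q.map fun e => (v :: e.1, mscale a e.2)) i j = (a : ℝ) * y v * matVal y Q i j := by
  induction Q with
  | nil => simp [matVal]
  | cons e Q ih =>
      rw [List.map_cons, matVal_cons, matVal_cons, ih, monoVal_cons']
      simp only [mscale]
      push_cast; ring

/-- **the formal derivative evaluates to `c₁(y) + 2 y_v c₂(y)`.** [folklore] -/
theorem spEval_spD (P : SPoly) (v : ℕ) (y : ℕ → ℝ) :
    spEval (spD P v) y = spEval (spCoeff P v 1) y + 2 * y v * spEval (spCoeff P v 2) y := by
  unfold spD
  rw [spEval_append, spEval_map_prepend]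
  push_cast; ring

/-- **the formal matrix derivative evaluates to `K₁(y) + 2 y_v K₂(y)`.** [folklore] -/
theorem matVal_mpD (L : List (Mono × Mat)) (v : ℕ) (y : ℕ → ℝ) (i j : Fin 3) :
    matVal y (mpD L v) i j = matVal y (mpCoeff L v 1) i j + 2 * y v * matVal y (mpCoeff L v 2) i j := by
  unfold mpD
  have happ : ∀ (A Bq : List (Mono × Mat)), matVal y (A ++ Bq) i j = matVal y A i j + matVal y Bq i j := by
    intro A Bq; simp [matVal, List.map_append, List.sum_append]
  rw [happ, matVal_map_prepend]
  push_cast; ring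

/-! ## The second-derivative matrix at a point -/

/-- the contribution of one outer function `φ` with coefficient matrices `K, K′, K″/2`:
`(φ″ρ′² + 2 p₂ φ′) K + 2 φ′ ρ′ K′ + 2 φ K₂` -/
def d2Mat (φ0 φ1 φ2 ρ1 p2 : ℝ) (K K1 K2 : Fin 3 → Fin 3 → ℝ) : Fin 3 → Fin 3 → ℝ := fun i j =>
  (φ2 * ρ1 ^ 2 + 2 * p2 * φ1) * K i j + 2 * φ1 * ρ1 * K1 i j + 2 * φ0 * K2 i j

/-- **the second `v`-derivative matrix of the class model term at the point `y`.** -/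
def stilde (ρbar : ℚ) (P : SPoly) (Z Λ : List (Mono × Mat)) (v : ℕ) (y : ℕ → ℝ) : Fin 3 → Fin 3 → ℝ := fun i j =>
  let ρ := (ρbar : ℝ) + spEval P y
  let ρ1 := spEval (spD P v) y
  let p2 := spEval (spCoeff P v 2) y
  d2Mat (omegaT ρ) (omegaT1 ρ) (omegaT2 ρ) ρ1 p2 (matVal y Z) (matVal y (mpD Z v)) (matVal y (mpCoeff Z v 2)) i j
    + d2Mat (psiT ρ) (psiT1 ρ) (psiT2 ρ) ρ1 p2 (matVal y Λ) (matVal y (mpD Λ v)) (matVal y (mpCoeff Λ v 2)) i j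

/-- `g2Mat` of a slice term at `t`, rewritten at the point `y = x[v ↦ t]`. [folklore] -/
theorem g2Mat_eq_d2Mat (s : SliceTerm) {P : SPoly} {L : List (Mono × Mat)} {v : ℕ} (ρbar : ℚ)
    (hP : spDegLe P v 2 = true) (hL : mpDegLe L v 2 = true) (x : ℕ → ℝ) (t : ℝ)
    (hr0 : s.r0 = (ρbar : ℝ) + spEval (spCoeff P v 0) x) (hr1 : s.r1 = spEval (spCoeff P v 1) x)
    (hr2 : s.r2 = spEval (spCoeff P v 2) x) (i j : Fin 3) :
    g2Mat s (matVal x (mpCoeff L v 0)) (matVal x (mpCoeff L v 1)) (matVal x (mpCoeff L v 2)) t i j =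
      d2Mat (s.φ ((ρbar : ℝ) + spEval P (update x v t))) (s.φ1 ((ρbar : ℝ) + spEval P (update x v t)))
        (s.φ2 ((ρbar : ℝ) + spEval P (update x v t))) (spEval (spD P v) (update x v t))
        (spEval (spCoeff P v 2) (update x v t)) (matVal (update x v t) L) (matVal (update x v t) (mpD L v))
        (matVal (update x v t) (mpCoeff L v 2)) i j := by
  have hρ : s.rho t = (ρbar : ℝ) + spEval P (update x v t) := by
    rw [SliceTerm.rho, spEval_update P v hP, hr0, hr1, hr2]; ring
  have hρ1 : s.rho1 t = spEval (spD P v) (update x v t) := by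
    rw [SliceTerm.rho1, spEval_spD, spEval_spCoeff_update, spEval_spCoeff_update, update_self, hr1, hr2]; ring
  simp only [g2Mat, d2Mat]
  rw [hρ, hρ1, hr2, matVal_update L v hL x t, matVal_mpD, matVal_mpCoeff_update, matVal_mpCoeff_update, update_self,
    spEval_spCoeff_update]

/-- **the sum of the two `g2Mat`s of a class along a slice is `stilde` at the slice point.** [folklore] -/
theorem g2_sum_eq_stilde (ρbar : ℚ) {P : SPoly} {Z Λ : List (Mono × Mat)} (c : BondClass) {v : ℕ}
    (hP : spDegLe P v 2 = true) (hZ : mpDegLe Z v 2 = true) (hΛ : mpDegLe Λ v 2 = true) (x : ℕ → ℝ)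
    (w : Label → E3) (t : ℝ) (i j : Fin 3) :
    g2Mat (sliceOmega ρbar P Z c v x w) (matVal x (mpCoeff Z v 0)) (matVal x (mpCoeff Z v 1)) (matVal x (mpCoeff Z v 2)) t i j
      + g2Mat (slicePsi ρbar P Λ c v x w) (matVal x (mpCoeff Λ v 0)) (matVal x (mpCoeff Λ v 1)) (matVal x (mpCoeff Λ v 2)) t i j
      = stilde ρbar P Z Λ v (update x v t) i j := by
  rw [g2Mat_eq_d2Mat (sliceOmega ρbar P Z c v x w) ρbar hP hZ x t rfl rfl rfl,
    g2Mat_eq_d2Mat (slicePsi ρbar P Λ c v x w) ρbar hP hΛ x t rfl rfl rfl]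
  rfl

/-! ## Interval enclosure of `stilde` over a box -/

/-- interval of an inverse-power combination `a ρ^{-m} + b ρ^{-n}` over a positive interval (`m, n : ℕ`) -/
def ipcIvl (a : ℚ) (m : ℕ) (b : ℚ) (n : ℕ) (I : Ivl) : Ivl := Ivl.add (Ivl.smul a (Ivl.powInv m I)) (Ivl.smul b (Ivl.powInv n I))

/-- soundness of `ipcIvl`. [folklore] -/
theorem mem_ipcIvl (a : ℚ) (m : ℕ) (b : ℚ) (n : ℕ) {I : Ivl} (hI : 0 < I.lo) {ρ : ℝ} (hρ : I.mem ρ) :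
    (ipcIvl a m b n I).mem (ipc a (-(m : ℤ)) b (-(n : ℤ)) ρ) := by
  unfold ipcIvl ipc
  rw [zpow_neg, zpow_neg, zpow_natCast, zpow_natCast]
  exact Ivl.mem_add (Ivl.mem_smul a (Ivl.mem_powInv m hI hρ)) (Ivl.mem_smul b (Ivl.mem_powInv n hI hρ))

/-- the six outer-function intervals over the `ρ`-interval: `ω̃, ω̃′, ω̃″, ψ̃, ψ̃′, ψ̃″` -/
def phiIvls (I : Ivl) : Ivl × Ivl × Ivl × Ivl × Ivl × Ivl :=
  (ipcIvl 14 8 (-8) 5 I, ipcIvl (-112) 9 40 6 I, ipcIvl 1008 10 (-240) 7 I,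
    ipcIvl (-1) 7 1 4 I, ipcIvl 7 8 (-4) 5 I, ipcIvl (-56) 9 20 6 I)

/-- soundness of the six outer-function intervals. [folklore] -/
theorem mem_phiIvls {I : Ivl} (hI : 0 < I.lo) {ρ : ℝ} (hρ : I.mem ρ) :
    (phiIvls I).1.mem (omegaT ρ) ∧ (phiIvls I).2.1.mem (omegaT1 ρ) ∧ (phiIvls I).2.2.1.mem (omegaT2 ρ) ∧
      (phiIvls I).2.2.2.1.mem (psiT ρ) ∧ (phiIvls I).2.2.2.2.1.mem (psiT1 ρ) ∧ (phiIvls I).2.2.2.2.2.mem (psiT2 ρ) := by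
  refine ⟨?_, ?_, ?_, ?_, ?_, ?_⟩
  · rw [omegaT_eq_ipc]; simpa [phiIvls] using mem_ipcIvl 14 8 (-8) 5 hI hρ
  · simpa [phiIvls, omegaT1] using mem_ipcIvl (-112) 9 40 6 hI hρ
  · simpa [phiIvls, omegaT2] using mem_ipcIvl 1008 10 (-240) 7 hI hρ
  · rw [psiT_eq_ipc]; simpa [phiIvls] using mem_ipcIvl (-1) 7 1 4 hI hρ
  · simpa [phiIvls, psiT1] using mem_ipcIvl 7 8 (-4) 5 hI hρ
  · simpa [phiIvls, psiT2] using mem_ipcIvl (-56) 9 20 6 hI hρ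

/-- interval of one `d2Mat` entry from intervals of its scalar and matrix ingredients -/
def d2Ivl (J0 J1 J2 R1 Q2 K K1 K2 : Ivl) : Ivl :=
  Ivl.add (Ivl.add (Ivl.mul (Ivl.add (Ivl.mul J2 (Ivl.mul R1 R1)) (Ivl.smul 2 (Ivl.mul Q2 J1))) K)
    (Ivl.smul 2 (Ivl.mul (Ivl.mul J1 R1) K1))) (Ivl.smul 2 (Ivl.mul J0 K2))

/-- soundness of `d2Ivl`. [folklore] -/
theorem mem_d2Ivl {J0 J1 J2 R1 Q2 K K1 K2 : Ivl} {φ0 φ1 φ2 ρ1 p2 k k1 k2 : ℝ} (h0 : J0.mem φ0) (h1 : J1.mem φ1)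
    (h2 : J2.mem φ2) (hr : R1.mem ρ1) (hq : Q2.mem p2) (hk : K.mem k) (hk1 : K1.mem k1) (hk2 : K2.mem k2) :
    (d2Ivl J0 J1 J2 R1 Q2 K K1 K2).mem ((φ2 * ρ1 ^ 2 + 2 * p2 * φ1) * k + 2 * φ1 * ρ1 * k1 + 2 * φ0 * k2) := by
  unfold d2Ivl
  have e1 : (φ2 * ρ1 ^ 2 + 2 * p2 * φ1) * k = (φ2 * (ρ1 * ρ1) + ((2 : ℚ) : ℝ) * (p2 * φ1)) * k := by push_cast; ring
  have e2 : 2 * φ1 * ρ1 * k1 = ((2 : ℚ) : ℝ) * (φ1 * ρ1 * k1) := by push_cast; ring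
  have e3 : 2 * φ0 * k2 = ((2 : ℚ) : ℝ) * (φ0 * k2) := by push_cast; ring
  rw [e1, e2, e3]
  exact Ivl.mem_add (Ivl.mem_add (Ivl.mem_mul (Ivl.mem_add (Ivl.mem_mul h2 (Ivl.mem_mul hr hr))
    (Ivl.mem_smul 2 (Ivl.mem_mul hq h1))) hk) (Ivl.mem_smul 2 (Ivl.mem_mul (Ivl.mem_mul h1 hr) hk1)))
    (Ivl.mem_smul 2 (Ivl.mem_mul h0 hk2))

/-- the `ρ`-interval of a class over a box -/
def rhoIvl (ρbar : ℚ) (P : SPoly) (B : Box) : Ivl := Ivl.add (Ivl.const ρbar) (spIvl B P)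

/-- soundness of the `ρ`-interval. [folklore] -/
theorem mem_rhoIvl (ρbar : ℚ) (P : SPoly) {B : Box} {y : ℕ → ℝ} (hy : B.mem y) :
    (rhoIvl ρbar P B).mem ((ρbar : ℝ) + spEval P y) :=
  Ivl.mem_add (Ivl.mem_const ρbar) (mem_spIvl hy P)

/-- **interval enclosure of an entry of `stilde` over a box.** -/
def stildeIvl (ρbar : ℚ) (P : SPoly) (Z Λ : List (Mono × Mat)) (v : ℕ) (B : Box) (i j : Fin 3) : Ivl :=
  let I := rhoIvl ρbar P B
  let F := phiIvls I
  let R1 := spIvl B (spD P v)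
  let Q2 := spIvl B (spCoeff P v 2)
  Ivl.add (d2Ivl F.1 F.2.1 F.2.2.1 R1 Q2 (mpIvl B Z i j) (mpIvl B (mpD Z v) i j) (mpIvl B (mpCoeff Z v 2) i j))
    (d2Ivl F.2.2.2.1 F.2.2.2.2.1 F.2.2.2.2.2 R1 Q2 (mpIvl B Λ i j) (mpIvl B (mpD Λ v) i j) (mpIvl B (mpCoeff Λ v 2) i j))

/-- **soundness of the `stilde` enclosure.** [folklore] -/
theorem mem_stildeIvl (ρbar : ℚ) (P : SPoly) (Z Λ : List (Mono × Mat)) (v : ℕ) {B : Box}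
    (hpos : 0 < (rhoIvl ρbar P B).lo) {y : ℕ → ℝ} (hy : B.mem y) (i j : Fin 3) :
    (stildeIvl ρbar P Z Λ v B i j).mem (stilde ρbar P Z Λ v y i j) := by
  obtain ⟨h0, h1, h2, h3, h4, h5⟩ := mem_phiIvls hpos (mem_rhoIvl ρbar P hy)
  unfold stildeIvl stilde
  simp only [d2Mat]
  exact Ivl.mem_add
    (mem_d2Ivl h0 h1 h2 (mem_spIvl hy _) (mem_spIvl hy _) (mem_mpIvl hy Z i j) (mem_mpIvl hy _ i j) (mem_mpIvl hy _ i j))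
    (mem_d2Ivl h3 h4 h5 (mem_spIvl hy _) (mem_spIvl hy _) (mem_mpIvl hy Λ i j) (mem_mpIvl hy _ i j) (mem_mpIvl hy _ i j))

/-- Anchor of this support file (registered stub of the line skeleton, lead c2): the formal matrix derivative of zero. -/
theorem stub_certStilde : mpD [] 1 = [] := by
  rfl

end Summit.AtomisticToContinuum.Crystallization.Theorems.PhononStabilityCWC.Cert

end
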